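import Summits.HodgeConjecture.CorCM.Census.CyclicCharacterArcReduction
import Summits.HodgeConjecture.CorCM.Census.TwoAdicSplittingTraceResidual

/-!
# Cyclic characters, VIII: THE ARC-TYPE META THEOREMS — `μ(G, c) = φ₂(G, c)` from a cover of the arc block, single-flip reductions and a count

COR-CM (cell `pub-hodgecm2`), count-neutral kernel combinatorics by the binder seat b09 (gen 41; lane CYCLIC-CHARACTER FIBRE LAW, part X — the assembly
theorems of the arc-type road map), on part IX (`Census/CyclicCharacterArcReduction.two_pow_smul_mem_psp_of_single_flips`), gen 38ʼs two-adic splitting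
(`Census/TwoAdicSplitting.isLeast_card_gfaces_generate_of_isPGroup`), gen 40ʼs relative splitting (`Census/TwoAdicSplittingRelative.…_rel`) and group-free
residual criterion (`Census/TwoAdicSplittingTraceResidual.isLeast_card_gfaces_generate_of_cover_of_supported`), all BY NAME.  Theorems only (no definition,
no `decide`, no certificate, no named fact, no `sorry`).
HONEST FRAMING: `HC_CM` is NOT proved, here or anywhere in the tree; nothing here is a period or a headline.

THE SHAPE OF THE μ-SIDE FOR THE CLASS (`c` central involution, `w : G ↠ ℤ/2ᵏ` additive, `w c ≠ 0`; `T_0 = w⁻¹(arc)` the arc type).  A finite face family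
`S₀` is an ARC-TYPE CERTIFICATE if
  (cov)  every type reduces INTEGRALLY, modulo `ℤ⟨pairs⟩ + ℤ[G]·S₀`, to the types of potential `≤ 1` w.r.t. the arc block (gen 38ʼs cover of `T_0` inside `S₀`:
         `BaseBlock.exists_cover_residual`, one face per block of potential `≥ 2`, for free);
  (flip) every SINGLE FLIP `T_0^{(s)}` reduces, modulo the same lattice, to the arc block up to `2ʲ` (the «closing faces» of the road map);
  (ind)  `S₀` is fibre-independent.
Then:
* §1 **2-GROUPS** (`isLeast_card_gfaces_generate_of_arcCert_isPGroup`): `μ(G, c) = φ₂(G, c)` — no further hypothesis (part IX gives `2ʲ·hodgeSpan ≤ ℤ⟨pairs⟩ +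
  ℤ[G]·S₀`, gen 38ʼs splitting completes `S₀` by free fibre faces).  Targets: `ℤ/4 ⋊ ℤ/4` (both central `c`), `Q₈ ×_ε ℤ/2ᵏ`, `ℤ/8 ⋊ ℤ/4`, `D₄ ×_ε ℤ/2ᵏ`, …
  (numerics of the road map: certificates with `|S₀| = φ₂` exist in every row computed).
* §2 **ANY GROUP, relative form** (`isLeast_card_gfaces_generate_of_arcCert_rel`): plus a factorisation `G = ι(Γ)·⟨N⟩` (`Γ` a 2-group) and the
  `N`-coboundary condition mod `2` — the metacyclic column `ℤ/m ⋊ ℤ/2ᵏ` (`Γ = ⟨y⟩`, `N = ℤ/m`).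
* §3 **ANY GROUP, group-free form** (`isLeast_card_gfaces_generate_of_arcCert_supported`): plus mod-2 generation of the Hodge vectors supported on the near zone;
  then also `|S₀| = φ₂`.

## References
* [Pohlmann1968] H. Pohlmann, Algebraic cycles on abelian varieties of complex multiplication type, Ann. of Math. 88 (1968), Thm 1.
* [Milne1999] J. S. Milne, Lefschetz motives and the Tate conjecture, Compositio Math. 117 (1999), Prop. 2.1, p. 54.
-/

namespace Summit.HodgeConjecture.CorCM.Census.CyclicCharacter

open Finset
open Summit.HodgeConjecture.CorCM.Prior.AllgGroup.RfwfAllgGroup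
open Summit.HodgeConjecture.CorCM.Census.BlockParity
open Summit.HodgeConjecture.CorCM.Census.Coinvariant
open Summit.HodgeConjecture.CorCM.Census.BaseBlock
open Summit.HodgeConjecture.CorCM.Census.Splitting

noncomputable section

variable {G : Type*} [Group G] [Fintype G] [DecidableEq G] {k : ℕ} {w : G → ZMod (2 ^ k)} {c : G}

/-! ## §1 Two-groups: an arc-type certificate gives the law -/

/-- **ARC-TYPE META THEOREM FOR 2-GROUPS: `μ(G, c) = φ₂(G, c)`** from a fibre-independent face family containing a cover of the arc block and reducing the
single flips of `T_0` up to `2ʲ`. [folklore] -/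
theorem isLeast_card_gfaces_generate_of_arcCert_isPGroup [Fintype (CMF G c)] (hG : IsPGroup 2 G) (hw : ∀ P Q : G, w (P * Q) = w P + w Q)
    (hk : 1 ≤ k) (hc2 : c * c = 1) (hcen : ∀ x : G, x * c = c * x) (hwc : w c ≠ 0) (h1 : ∃ g₁ : G, w g₁ = 1)
    (S₀ : Finset (CMF G c →₀ ℤ)) (hS₀ : (↑S₀ : Set (CMF G c →₀ ℤ)) ⊆ gfaceSet G c hc2)
    (hli : LinearIndepOn (ZMod 2) (fun f : CMF G c →₀ ℤ => (rad2 c hc2).mkQ (red c f)) ↑S₀) (j : ℕ)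
    (hcov : ∀ Φ : CMF G c, Finsupp.single Φ (1 : ℤ) ∈
      (Submodule.span ℤ (pairSet c) ⊔ Submodule.span ℤ (translates c S₀)) ⊔
        Submodule.span ℤ ((fun Ψ => Finsupp.single Ψ (1 : ℤ)) '' {Ψ : CMF G c | bpot c (arcType hw hk hc2 hwc 0) Ψ ≤ 1}))
    (hflip : ∀ s ∈ (arcType hw hk hc2 hwc 0).1, ((2 : ℤ) ^ j) • Finsupp.single (oflipCM c hc2 s (arcType hw hk hc2 hwc 0)) (1 : ℤ) ∈
      (Submodule.span ℤ (pairSet c) ⊔ Submodule.span ℤ (translates c S₀)) ⊔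
        Submodule.span ℤ (Set.range fun Q : G => Finsupp.single (rt c Q (arcType hw hk hc2 hwc 0)) (1 : ℤ))) :
    IsLeast {n : ℕ | ∃ S : Finset (CMF G c →₀ ℤ), (↑S ⊆ gfaceSet G c hc2) ∧ S.card = n ∧
      hodgeSpan c hc2 ≤ Submodule.span ℤ (pairSet c) ⊔ Submodule.span ℤ (translates c S)} (fibreTwo c hc2) :=
  isLeast_card_gfaces_generate_of_isPGroup c hG hc2 (c_ne_one hw hwc) hcen S₀ hS₀ hli j
    (two_pow_smul_mem_psp_of_single_flips hw hk hc2 hcen hwc h1 S₀ (hS₀.trans (gfaceSet_subset_hodgeSpan c hc2)) j hcov hflip)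

/-! ## §2 Any group, relative form: plus a `2`-group factorisation and the `N`-coboundaries -/

/-- **ARC-TYPE META THEOREM, RELATIVE FORM: `μ(G, c) = φ₂(G, c)`** for `G = ι(Γ)·⟨N⟩` (`Γ` a `2`-group) from an arc-type certificate whose target contains
the `N`-coboundaries of the faces mod `2` — the metacyclic column `ℤ/m ⋊ ℤ/2ᵏ` (`Γ = ℤ/2ᵏ`, `N` a generator of `ℤ/m`). [folklore] -/
theorem isLeast_card_gfaces_generate_of_arcCert_rel [Fintype (CMF G c)] {Γ : Type*} [Group Γ] (hΓ : IsPGroup 2 Γ) (ι : Γ →* G) (N : Set G)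
    (hfac : ∀ Q : G, ∃ γ : Γ, ∃ n ∈ Subgroup.closure N, Q = ι γ * n)
    (hw : ∀ P Q : G, w (P * Q) = w P + w Q) (hk : 1 ≤ k) (hc2 : c * c = 1) (hcen : ∀ x : G, x * c = c * x) (hwc : w c ≠ 0)
    (h1 : ∃ g₁ : G, w g₁ = 1) (S₀ : Finset (CMF G c →₀ ℤ)) (hS₀ : (↑S₀ : Set (CMF G c →₀ ℤ)) ⊆ gfaceSet G c hc2)
    (hli : LinearIndepOn (ZMod 2) (fun f : CMF G c →₀ ℤ => (rad2 c hc2).mkQ (red c f)) ↑S₀)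
    (hN : ∀ n ∈ N, ∀ f ∈ gfaceSet G c hc2, red c (Finsupp.mapDomain (rt c n) f - f) ∈
      pair2 c ⊔ Submodule.span (ZMod 2) (translates2 c (S₀.image (red c)))) (j : ℕ)
    (hcov : ∀ Φ : CMF G c, Finsupp.single Φ (1 : ℤ) ∈
      (Submodule.span ℤ (pairSet c) ⊔ Submodule.span ℤ (translates c S₀)) ⊔
        Submodule.span ℤ ((fun Ψ => Finsupp.single Ψ (1 : ℤ)) '' {Ψ : CMF G c | bpot c (arcType hw hk hc2 hwc 0) Ψ ≤ 1}))
    (hflip : ∀ s ∈ (arcType hw hk hc2 hwc 0).1, ((2 : ℤ) ^ j) • Finsupp.single (oflipCM c hc2 s (arcType hw hk hc2 hwc 0)) (1 : ℤ) ∈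
      (Submodule.span ℤ (pairSet c) ⊔ Submodule.span ℤ (translates c S₀)) ⊔
        Submodule.span ℤ (Set.range fun Q : G => Finsupp.single (rt c Q (arcType hw hk hc2 hwc 0)) (1 : ℤ))) :
    IsLeast {n : ℕ | ∃ S : Finset (CMF G c →₀ ℤ), (↑S ⊆ gfaceSet G c hc2) ∧ S.card = n ∧
      hodgeSpan c hc2 ≤ Submodule.span ℤ (pairSet c) ⊔ Submodule.span ℤ (translates c S)} (fibreTwo c hc2) :=
  isLeast_card_gfaces_generate_of_isPGroup_rel c hΓ ι N hfac hc2 (c_ne_one hw hwc) hcen S₀ hS₀ hli hN j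
    (two_pow_smul_mem_psp_of_single_flips hw hk hc2 hcen hwc h1 S₀ (hS₀.trans (gfaceSet_subset_hodgeSpan c hc2)) j hcov hflip)

/-! ## §3 Any group, group-free form: plus mod-`2` generation of the near zone -/

/-- **ARC-TYPE META THEOREM, GROUP-FREE FORM: `|S₀| = φ₂(G, c)` and `μ(G, c) = φ₂(G, c)`** from an arc-type certificate which moreover generates mod `2`
every Hodge vector mod `2` supported on the near zone (potential `≤ 1`) — any finite `G`. [folklore] -/
theorem isLeast_card_gfaces_generate_of_arcCert_supported [Fintype (CMF G c)] (hw : ∀ P Q : G, w (P * Q) = w P + w Q) (hk : 1 ≤ k)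
    (hc2 : c * c = 1) (hcen : ∀ x : G, x * c = c * x) (hwc : w c ≠ 0) (h1 : ∃ g₁ : G, w g₁ = 1)
    (S₀ : Finset (CMF G c →₀ ℤ)) (hS₀ : (↑S₀ : Set (CMF G c →₀ ℤ)) ⊆ gfaceSet G c hc2)
    (hli : LinearIndepOn (ZMod 2) (fun f : CMF G c →₀ ℤ => (rad2 c hc2).mkQ (red c f)) ↑S₀) (j : ℕ)
    (hcov : ∀ Φ : CMF G c, Finsupp.single Φ (1 : ℤ) ∈
      (Submodule.span ℤ (pairSet c) ⊔ Submodule.span ℤ (translates c S₀)) ⊔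
        Submodule.span ℤ ((fun Ψ => Finsupp.single Ψ (1 : ℤ)) '' {Ψ : CMF G c | bpot c (arcType hw hk hc2 hwc 0) Ψ ≤ 1}))
    (hres : ∀ y ∈ hodge2 c hc2, y ∈ Finsupp.supported (ZMod 2) (ZMod 2) {Ψ : CMF G c | bpot c (arcType hw hk hc2 hwc 0) Ψ ≤ 1} →
      y ∈ pair2 c ⊔ Submodule.span (ZMod 2) (translates2 c (S₀.image (red c))))
    (hflip : ∀ s ∈ (arcType hw hk hc2 hwc 0).1, ((2 : ℤ) ^ j) • Finsupp.single (oflipCM c hc2 s (arcType hw hk hc2 hwc 0)) (1 : ℤ) ∈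
      (Submodule.span ℤ (pairSet c) ⊔ Submodule.span ℤ (translates c S₀)) ⊔
        Submodule.span ℤ (Set.range fun Q : G => Finsupp.single (rt c Q (arcType hw hk hc2 hwc 0)) (1 : ℤ))) :
    S₀.card = fibreTwo c hc2 ∧
    IsLeast {n : ℕ | ∃ S : Finset (CMF G c →₀ ℤ), (↑S ⊆ gfaceSet G c hc2) ∧ S.card = n ∧
      hodgeSpan c hc2 ≤ Submodule.span ℤ (pairSet c) ⊔ Submodule.span ℤ (translates c S)} (fibreTwo c hc2) :=
  isLeast_card_gfaces_generate_of_cover_of_supported c hc2 (c_ne_one hw hwc) hcen S₀ hS₀ hli _ hcov hres j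
    (two_pow_smul_mem_psp_of_single_flips hw hk hc2 hcen hwc h1 S₀ (hS₀.trans (gfaceSet_subset_hodgeSpan c hc2)) j hcov hflip)

end

end Summit.HodgeConjecture.CorCM.Census.CyclicCharacter
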